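import Summits.HodgeConjecture.HodgeConjecture.Theorems.F0P3RelParityOfRecordW       -- ★6 (w3) `relSharpOneMeasure_of_rowsW`, `lawsV8_kitFamilyOfRecordW_of_rows` (the `h2` edition); brings ★ `F0P3RelParityOfT5`, ★ V8W, ★ `F0P3KitOfRecordW`
import Summits.HodgeConjecture.HodgeConjecture.Theorems.F0P3ThreadLetters3Defs         -- ★ p864888 `KitFamilyLaws₃` (S5-R20: ONE text home, BY NAME)
import HarnessLib

/-!
# `F0P3RelParityOfRecordW3` — THREAD-₃ twin of the REL♯¹ export: «REL♯ AT ONE AUTOMORPHIC MEASURE ⟸ T5» at frames with TWO COMPACT PLACES (`3 ≤ [L⁺:ℚ]`),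
# kit-generic (§1) and at the kit family of record from the closer's fourteen rows (§§2–3) — theorems only, 0 `sorry`

Cell `hodgecm-mathlib`, crux item `stmt-HodgeConjecture-24833` (h413), route `route-HodgeConjecture-HCCMUnconditional`.  Typist LH7-typ2 (g4) (planner seat; a prover hand
files, `--supports stmt-HodgeConjecture-24833`), heir LEAD F0P3a-plan T21-28 (R-44)(C)(6) ∕ T21-31 (R-45) «THREAD-₃ ROAD», S5 dealer R90-C133-plan RULINGS S5-R19 («₃ twins
live Summits-side; ONE inserted line `3 ≤ Module.finrank ℚ ↥(maximalRealSubfield L) →` after the kept `2 ≤ …` line») ∕ S5-R20 («ONE TEXT HOME» ★ `F0P3ThreadLetters3Defs`),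
director s2043 «THREAD-₃ REGISTRY SHAPE» (iii): «`3 ≤ [F⁺:ℚ]` is implied by Hyp413 (`6 ≤ [F:ℚ]`); the weakening costs nothing at the summit; anchor [Rogawski1990 §13.3
(13.3.6(c)), two compact places]».

WHY THIS FILE (census LH7-typ2 (g4) 2026-09-05 03:22Z).  The closer AGG `Cruxes/H413/Lines/F0_U3LettersRung1.lean` DERIVES two things from its rung-0 rows `rows_of_rung0`:
the HJ3a line's letters (`letters_of_rung0`, ★ `letters_of_specPkgV8W_cot`) AND the REL♯¹ export `relSharpOne_of_rung1 := ★ relSharpOneMeasure_of_rowsW frameDataOfRung0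
rows_of_rung0` (books #162 «CLOSED-DERIVED»).  At AGG's «₃-THREAD» edition the socket `stub_S2sharp` (h2) is replaced by `stub_S2sharp₃ : S2SharpLetter₃` (two compact
places), so the rows — and everything read off them — carry the extra binder `3 ≤ [L⁺:ℚ]`.  Lane 2 (E-1 … E-4) re-threads the HJ3a letters; THIS module re-threads the
REL♯¹ export, so that AGG's `relSharpOne_of_rung1` keeps deriving (its TYPE gains the one `3 ≤` line; body `relSharpOneMeasure_of_rowsW₃ frameDataOfRung0 rows_of_rung0`).

* §1 **`relSharpGuardedOneMeasure₃_of_T5 (𝔎) (hpin) (hlaws₃ : KitFamilyLaws₃ 𝔎)`** — twin of ★ `F0P3RelParityOfT5.relSharpGuardedOneMeasure_of_T5` (§7, ED. 2): the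
  one-measure REL♯ text with `3 ≤ …` after `2 ≤ …`; proof = ★ `relSharp_of_laws` BY NAME at the ONE frame, the laws now asked only at frames with two compact places
  (the kit family and its pins are `h2` objects and need no twin — ★ `F0P3ThreadLetters3Defs` §2).
* §2 **`lawsV8_kitFamilyOfRecordW_of_rows₃ 𝔇W h`** — twin of ★ `lawsV8_kitFamilyOfRecordW_of_rows`: the ₃ LAWS of the W family of record from the fourteen per-frame
  rows asked at frames with two compact places (`h` = ★-to-be (E-1) `letters_of_specPkgV8W_cot₃`'s hypothesis BYTE-VERBATIM: `(h3 : 3 ≤ …)` right after `(h2 : …)`);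
  proof ★ `laws₈_kitOfRecordW_of₄` VERBATIM (`h3` intro'd, unused by the kit — only the rows need it).
* §3 HEAD **`relSharpOneMeasure_of_rowsW₃ 𝔇W h`** := §1 at `kitFamilyOfRecordW 𝔇W`, pinned by ★ `isPinned_kitFamilyOfRecordW`, laws by §2 — conclusion = ★ (w3)'s
  conclusion + the ONE `3 ≤` line = AGG ₃'s `relSharpOne_of_rung1` TYPE token for token.

DEF∕PROOF discipline: theorems only; no `def`, no instance, no notation, no `sorry`; imports ★ `Theorems` only (never a `Cruxes/…/Lines` module).  Downstream notice (desk
F0P2-plan): the REL-ENGINE junction `stub_relSharp1` (h2 text `StubRelSharpParityOne`) re-threads by the same one line at its own edition.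
HONEST LABEL: this file discharges NOTHING by itself (kit-generic over T5's pins + ₃ laws; at the family of record its open content is the closer's registered stub set);
HC_CM is proved only modulo the 7 printed citations (2 remaining named inputs: hLiu418 = stmt-HodgeConjecture-24832, h413 = stmt-HodgeConjecture-24833) until rung 0 closes.
[cite: Rogawski1990, §14.6 Thm. 14.6.4 pp. 236–244; §13.1 Prop. 13.1.3 (d) p. 199; §15.2 Prop. 15.2.1 p. 244; §15.3 ¶1 p. 244; §13.3 Thm. 13.3.6 (c)]
-/

set_option autoImplicit false
-- the mandated namespace repeats `HodgeConjecture.HodgeConjecture`, as in every `Theorems/*.lean` of this sub-problem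
set_option linter.dupNamespace false

noncomputable section

open NumberField IsDedekindDomain MeasureTheory
open Literature.NumberTheory.Rogawski1990 Literature.NumberTheory.GaloisRepresentations
open Literature.NumberTheory.Automorphic Literature.NumberTheory.Automorphic.UnitaryGroup
open Literature.NumberTheory.Automorphic.UnitaryGroup.CotangentForms
open scoped Matrix ComplexOrder
open Summit.HodgeConjecture.HodgeConjecture.Cruxes.H413.F0P3XiArchPacketOfRecord (JInfNoDegOne DsInfNoDegOne)

namespace Summit.HodgeConjecture.HodgeConjecture.Cruxes.H413.F0P3RelParityOfRecordW3

open Summit.HodgeConjecture.HodgeConjecture.Cruxes.H413.F0P3InnerFormClassificationV6 (Sockets Gp Places Cinf IsCot KcTrivial)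
open Summit.HodgeConjecture.HodgeConjecture.Cruxes.H413.F0P3KitOfRecord
open Summit.HodgeConjecture.HodgeConjecture.Cruxes.H413.F0P3KitOfRecordW

/-! ## §1 KIT-GENERIC: REL♯ at ONE automorphic measure from a PINNED kit family with the ₃ LAWS -/

set_option synthInstance.maxHeartbeats 400000 in
set_option maxHeartbeats 400000 in
-- the head's statement is the REL♯ text at ONE automorphic measure (same scoped budget as ★ `F0P3RelParityOfT5` §7)
/-- **REL♯ AT ONE AUTOMORPHIC MEASURE ⟸ T5, frames with TWO COMPACT PLACES** — twin of ★ `F0P3RelParityOfT5.relSharpGuardedOneMeasure_of_T5`: a PINNED kit family `𝔎`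
with the LAWS at every letters' frame with `3 ≤ [L⁺:ℚ]` (★ `F0P3ThreadLetters3Defs.KitFamilyLaws₃`) gives, at every such frame and ONE automorphic measure `μA`, that two
(hol ∨ antihol)-cotangent discrete `P`, `P′` of `U(H)` in ONE ξ-local family have supercuspidal labels differing at an EVEN number of finite places of `L⁺` (the E0 seam is
`rfl` ×5 at one measure).  Statement = ★ §7's text + the ONE line `3 ≤ Module.finrank ℚ ↥(maximalRealSubfield L) →` after `2 ≤ …` (S5-R19).
[cite: Rogawski1990, §14.6 Thm. 14.6.4 pp. 236–239; §13.1 Prop. 13.1.3 (d) p. 199; §15.2 Prop. 15.2.1 p. 244; §13.3 Thm. 13.3.6 (c)] -/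
theorem relSharpGuardedOneMeasure₃_of_T5 (𝔎 : F0P3InnerFormClassificationV8.KitFamily) (hpin : F0P3InnerFormClassificationV8.KitFamily.IsPinned 𝔎)
    (hlaws₃ : F0P3ThreadLetters3Defs.KitFamilyLaws₃ 𝔎) :
    ∀ (L : Type) [Field L] [NumberField L] [IsCMField L] (ι : L →+* ℂ) (H : Matrix (Fin 3) (Fin 3) L) (T : GL (Fin 3) ℂ)
      (hT : (T : Matrix (Fin 3) (Fin 3) ℂ)ᴴ * H.map ι * (T : Matrix (Fin 3) (Fin 3) ℂ) = Literature.Geometry.ComplexHyperbolic.BallModel.J),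
      (∀ τ' : L →+* ℂ, InfinitePlace.mk τ' ≠ InfinitePlace.mk ι → (H.map τ').PosDef) → 2 ≤ Module.finrank ℚ ↥(maximalRealSubfield L) →
        3 ≤ Module.finrank ℚ ↥(maximalRealSubfield L) →
        ∀ (μA : Measure (adelicGroupData (↥(maximalRealSubfield L)) L (IsCMField.complexConj L) 3 H).automorphicQuotient)
          [(adelicGroupData (↥(maximalRealSubfield L)) L (IsCMField.complexConj L) 3 H).IsAutomorphicMeasure μA]
          (P P' : DiscreteAutomorphicRep (adelicGroupData (↥(maximalRealSubfield L)) L (IsCMField.complexConj L) 3 H) μA),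
          (P.IsHolCotangentAt (cmArchSection L ι H T hT) (cmCompactFactor L ι H T hT) ∨ P.IsAntiholCotangentAt (cmArchSection L ι H T hT) (cmCompactFactor L ι H T hT)) →
          (P'.IsHolCotangentAt (cmArchSection L ι H T hT) (cmCompactFactor L ι H T hT) ∨ P'.IsAntiholCotangentAt (cmArchSection L ι H T hT) (cmCompactFactor L ι H T hT)) →
          ∀ (μω : HeckeCharacter L) (hμu : μω.IsUnitary),
            (∀ x : Literature.NumberTheory.GaloisRepresentations.ideleGroup ↥(maximalRealSubfield L),
              μω (AdeleRing.ideleBaseChange (↥(maximalRealSubfield L)) L x) = quadraticHeckeCharCM L x) →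
          ∀ (ξ : OneDimAutRepH L),
            MemXiFamily P (transpose_map_cmConjRingHom_eq_of_frame L ι H T hT) (isUnit_det_of_frame L ι H T hT) μω hμu ξ →
            MemXiFamily P' (transpose_map_cmConjRingHom_eq_of_frame L ι H T hT) (isUnit_det_of_frame L ι H T hT) μω hμu ξ →
              Even ({v : HeightOneSpectrum (𝓞 ↥(maximalRealSubfield L)) | ¬ ((∃ c : IrrClass ((cmDatum L 3 H).Local v),
                  (IrrClass.comap (localPiEquiv L (IsCMField.complexConj L) 3 H v) c).IsConstituentOf
                      (P.finRep.smoothPart.toRepresentation.comp (inclPlace (↥(maximalRealSubfield L)) L (IsCMField.complexConj L) 3 H v)) ∧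
                    c.IsSupercuspidal) ↔
                (∃ c : IrrClass ((cmDatum L 3 H).Local v),
                  (IrrClass.comap (localPiEquiv L (IsCMField.complexConj L) 3 H v) c).IsConstituentOf
                      (P'.finRep.smoothPart.toRepresentation.comp (inclPlace (↥(maximalRealSubfield L)) L (IsCMField.complexConj L) 3 H v)) ∧
                    c.IsSupercuspidal))}.ncard) := by
  intro L _ _ _ ι H T hT hdef h2 h3 μA _ P P' hP hP' μω hμu hμω ξ hmem hmem'
  obtain ⟨S₀, hl⟩ := hlaws₃ L ι H T hT hdef h2 h3 μA μω hμu hμω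
  exact F0P3RelParityOfT5.relSharp_of_laws hdef h2 μA μA _ _ (hpin L ι H T hT hdef h2 μA μω hμu hμω) (hpin L ι H T hT hdef h2 μA μω hμu hμω) hμω hl hl
    (fun _ => ⟨rfl, rfl, rfl, rfl, rfl⟩) P P' hP hP' ξ hmem hmem'

/-! ## §2 THE ₃ LAWS OF THE W FAMILY OF RECORD FROM THE CLOSER'S FOURTEEN ROWS (frames with two compact places) -/

/-- **THE ₃ FAMILY LAWS FROM THE CLOSER'S FOURTEEN ROWS** — twin of ★ `lawsV8_kitFamilyOfRecordW_of_rows` (`h` = (E-1) `letters_of_specPkgV8W_cot₃`'s hypothesis verbatim: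
the fourteen conjuncts at ONE level `S₀` per frame, asked only at frames with `3 ≤ [L⁺:ℚ]`): ★ `laws₈_kitOfRecordW_of₄` (with `Factorisation` from `FactorisationCls` + the
package's `FactorisationPk`, ★ `factorisation_of_cls_of_pk`); the kit `kitFamilyOfRecordW 𝔇W L ι H T hT hdef h2 μ μω hμu hμω` takes no `h3`.
[cite: Rogawski1990, §14.6 Thm. 14.6.4 pp. 236–244; §14.2 p. 228; §13.3 Thm. 13.3.6 (c)] -/
theorem lawsV8_kitFamilyOfRecordW_of_rows₃
    (𝔇W : ∀ (L : Type) [Field L] [NumberField L] [IsCMField L] (ι : L →+* ℂ) (H : Matrix (Fin 3) (Fin 3) L) (T : GL (Fin 3) ℂ)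
      (hT : (T : Matrix (Fin 3) (Fin 3) ℂ)ᴴ * H.map ι * (T : Matrix (Fin 3) (Fin 3) ℂ) = Literature.Geometry.ComplexHyperbolic.BallModel.J),
      (∀ τ' : L →+* ℂ, InfinitePlace.mk τ' ≠ InfinitePlace.mk ι → (H.map τ').PosDef) →
      2 ≤ Module.finrank ℚ ↥(maximalRealSubfield L) →
      ∀ (μ : Measure (Gp L H).automorphicQuotient) [(Gp L H).IsAutomorphicMeasure μ] (μω : HeckeCharacter L) (_hμu : μω.IsUnitary),
      (∀ x : Literature.NumberTheory.GaloisRepresentations.ideleGroup ↥(maximalRealSubfield L),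
        μω (AdeleRing.ideleBaseChange (↥(maximalRealSubfield L)) L x) = quadraticHeckeCharCM L x) → FrameDataW L H ι T hT μ)
    (h : ∀ (L : Type) [Field L] [NumberField L] [IsCMField L] (ι : L →+* ℂ) (H : Matrix (Fin 3) (Fin 3) L) (T : GL (Fin 3) ℂ)
      (hT : (T : Matrix (Fin 3) (Fin 3) ℂ)ᴴ * H.map ι * (T : Matrix (Fin 3) (Fin 3) ℂ) = Literature.Geometry.ComplexHyperbolic.BallModel.J)
      (hdef : ∀ τ' : L →+* ℂ, InfinitePlace.mk τ' ≠ InfinitePlace.mk ι → (H.map τ').PosDef) (h2 : 2 ≤ Module.finrank ℚ ↥(maximalRealSubfield L)) (h3 : 3 ≤ Module.finrank ℚ ↥(maximalRealSubfield L))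
      (μ : Measure (Gp L H).automorphicQuotient) [(Gp L H).IsAutomorphicMeasure μ] (μω : HeckeCharacter L) (hμu : μω.IsUnitary)
      (hμω : ∀ x : Literature.NumberTheory.GaloisRepresentations.ideleGroup ↥(maximalRealSubfield L),
        μω (AdeleRing.ideleBaseChange (↥(maximalRealSubfield L)) L x) = quadraticHeckeCharCM L x),
      -- ONE level `S₀` per frame (v8, RULING (V44)); the witnessed package at `S₀` (K9β: `Classical.choose_spec`, unioned by `.mono`)
      ∃ S₀ : Finset (Places L),
      F0P3InnerFormClassificationV8.ClassificationKit.SpecPkg (kitFamilyOfRecordW 𝔇W L ι H T hT hdef h2 μ μω hμu hμω) S₀ ∧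
      -- #1 (T1's head at the overridden kit, K9β §A), TF (class factorisation), #2, #6, #7, #8, #10, #15 (v8 text, GUARDED `IsCot P → KcTrivial P → …` — ★ `routing₈_kitOfRecord_of_cot`)
      (kitFamilyOfRecordW 𝔇W L ι H T hT hdef h2 μ μω hμu hμω).TraceIdentity ∧
      F0P3InnerFormClassificationV8.ClassificationKit.FactorisationCls (kitFamilyOfRecordW 𝔇W L ι H T hT hdef h2 μ μω hμu hμω) S₀ ∧
      (kitFamilyOfRecordW 𝔇W L ι H T hT hdef h2 μ μω hμu hμω).SpectralSideGp ∧
      F0P3InnerFormClassificationV8.ClassificationKit.HatBounded (kitFamilyOfRecordW 𝔇W L ι H T hT hdef h2 μ μω hμu hμω) S₀ ∧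
      F0P3InnerFormClassificationV8.ClassificationKit.UnrStarAlgebra (kitFamilyOfRecordW 𝔇W L ι H T hT hdef h2 μ μω hμu hμω) S₀ ∧
      (kitFamilyOfRecordW 𝔇W L ι H T hT hdef h2 μ μω hμu hμω).LinIndepS ∧
      F0P3InnerFormClassificationV8.ClassificationKit.UnitaryPacket (kitFamilyOfRecordW 𝔇W L ι H T hT hdef h2 μ μω hμu hμω) S₀ ∧
      F0P3InnerFormClassificationV8.ClassificationKit.Routing (kitFamilyOfRecordW 𝔇W L ι H T hT hdef h2 μ μω hμu hμω) ∧
      -- the arch clauses on the family's `jInf dsInf` (R-22′) and the ξ-rows #20 #21 #23 (no #12 `FlathDet`, no «AFA»: RULINGS (V43)(V44))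
      JInfNoDegOne (𝔇W L ι H T hT hdef h2 μ μω hμu hμω).jInf ∧ DsInfNoDegOne (𝔇W L ι H T hT hdef h2 μ μω hμu hμω).dsInf ∧
      (kitFamilyOfRecordW 𝔇W L ι H T hT hdef h2 μ μω hμu hμω).XiFamilyFin μω hμu ∧
      (kitFamilyOfRecordW 𝔇W L ι H T hT hdef h2 μ μω hμu hμω).XiUnram ∧
      (kitFamilyOfRecordW 𝔇W L ι H T hT hdef h2 μ μω hμu hμω).EvpConvention) :
    F0P3ThreadLetters3Defs.KitFamilyLaws₃ (kitFamilyOfRecordW 𝔇W) := by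
  intro L _ _ _ ι H T hT hdef h2 h3 μ _ μω hμu hμω
  obtain ⟨S₀, hpk, h1, hTF, h2', h6, h7, h8, h10, h15, hJ, hD, h20, h21, h23⟩ := h L ι H T hT hdef h2 h3 μ μω hμu hμω
  letI : MeasurableSpace (Gp L H).Adelic := borel _
  haveI : BorelSpace (Gp L H).Adelic := ⟨rfl⟩
  haveI := (𝔇W L ι H T hT hdef h2 μ μω hμu hμω).isFiniteMeasureOnCompacts_ν
  exact ⟨S₀, laws₈_kitOfRecordW_of₄ L H ι T hT μ _ _ _ μω hμu _ _ _ _ _ _ _ _ S₀ hdef h2 h1 h2'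
    (F0P3InnerFormClassificationV8.ClassificationKit.factorisation_of_cls_of_pk _ hTF hpk.factorisationPk) hpk.matchingS hpk.transferS h6 h7 h8 h10
    hpk.aPacketSpectral hpk.localExpansion h15 hμω hJ hD h20 h21 h23⟩

/-! ## §3 THE HEAD AGG's ₃ edition consumes: REL♯ at ONE measure, at the kit family of record, from the fourteen rows (frames with two compact places) -/

set_option synthInstance.maxHeartbeats 400000 in
set_option maxHeartbeats 400000 in
-- the conclusion is the REL♯ text (scoped budget as in ★ `F0P3RelParityOfT5`)
/-- **REL♯ AT ONE AUTOMORPHIC MEASURE, AT THE KIT FAMILY OF RECORD, FROM THE FOURTEEN ROWS — ₃ EDITION** (twin of ★ `relSharpOneMeasure_of_rowsW`; the closer's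
one-token junction shape `relSharpOne_of_rung1 := relSharpOneMeasure_of_rowsW₃ frameDataOfRung0 rows_of_rung0` at AGG's ₃ edition): §1 at `kitFamilyOfRecordW 𝔇W`,
pinned by ★ `isPinned_kitFamilyOfRecordW` (no hypothesis), laws by §2.  Conclusion = ★ (w3)'s conclusion + the ONE line `3 ≤ Module.finrank ℚ ↥(maximalRealSubfield L) →`
after `2 ≤ …`. [cite: Rogawski1990, §14.6 Thm. 14.6.4 pp. 236–239; §13.1 Prop. 13.1.3 (d) p. 199; §15.2 Prop. 15.2.1 p. 244; §13.3 Thm. 13.3.6 (c)] -/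
theorem relSharpOneMeasure_of_rowsW₃
    (𝔇W : ∀ (L : Type) [Field L] [NumberField L] [IsCMField L] (ι : L →+* ℂ) (H : Matrix (Fin 3) (Fin 3) L) (T : GL (Fin 3) ℂ)
      (hT : (T : Matrix (Fin 3) (Fin 3) ℂ)ᴴ * H.map ι * (T : Matrix (Fin 3) (Fin 3) ℂ) = Literature.Geometry.ComplexHyperbolic.BallModel.J),
      (∀ τ' : L →+* ℂ, InfinitePlace.mk τ' ≠ InfinitePlace.mk ι → (H.map τ').PosDef) →
      2 ≤ Module.finrank ℚ ↥(maximalRealSubfield L) →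
      ∀ (μ : Measure (Gp L H).automorphicQuotient) [(Gp L H).IsAutomorphicMeasure μ] (μω : HeckeCharacter L) (_hμu : μω.IsUnitary),
      (∀ x : Literature.NumberTheory.GaloisRepresentations.ideleGroup ↥(maximalRealSubfield L),
        μω (AdeleRing.ideleBaseChange (↥(maximalRealSubfield L)) L x) = quadraticHeckeCharCM L x) → FrameDataW L H ι T hT μ)
    (h : ∀ (L : Type) [Field L] [NumberField L] [IsCMField L] (ι : L →+* ℂ) (H : Matrix (Fin 3) (Fin 3) L) (T : GL (Fin 3) ℂ)
      (hT : (T : Matrix (Fin 3) (Fin 3) ℂ)ᴴ * H.map ι * (T : Matrix (Fin 3) (Fin 3) ℂ) = Literature.Geometry.ComplexHyperbolic.BallModel.J)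
      (hdef : ∀ τ' : L →+* ℂ, InfinitePlace.mk τ' ≠ InfinitePlace.mk ι → (H.map τ').PosDef) (h2 : 2 ≤ Module.finrank ℚ ↥(maximalRealSubfield L)) (h3 : 3 ≤ Module.finrank ℚ ↥(maximalRealSubfield L))
      (μ : Measure (Gp L H).automorphicQuotient) [(Gp L H).IsAutomorphicMeasure μ] (μω : HeckeCharacter L) (hμu : μω.IsUnitary)
      (hμω : ∀ x : Literature.NumberTheory.GaloisRepresentations.ideleGroup ↥(maximalRealSubfield L),
        μω (AdeleRing.ideleBaseChange (↥(maximalRealSubfield L)) L x) = quadraticHeckeCharCM L x),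
      -- ONE level `S₀` per frame (v8, RULING (V44)); the witnessed package at `S₀` (K9β: `Classical.choose_spec`, unioned by `.mono`)
      ∃ S₀ : Finset (Places L),
      F0P3InnerFormClassificationV8.ClassificationKit.SpecPkg (kitFamilyOfRecordW 𝔇W L ι H T hT hdef h2 μ μω hμu hμω) S₀ ∧
      -- #1 (T1's head at the overridden kit, K9β §A), TF (class factorisation), #2, #6, #7, #8, #10, #15 (v8 text, GUARDED `IsCot P → KcTrivial P → …` — ★ `routing₈_kitOfRecord_of_cot`)
      (kitFamilyOfRecordW 𝔇W L ι H T hT hdef h2 μ μω hμu hμω).TraceIdentity ∧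
      F0P3InnerFormClassificationV8.ClassificationKit.FactorisationCls (kitFamilyOfRecordW 𝔇W L ι H T hT hdef h2 μ μω hμu hμω) S₀ ∧
      (kitFamilyOfRecordW 𝔇W L ι H T hT hdef h2 μ μω hμu hμω).SpectralSideGp ∧
      F0P3InnerFormClassificationV8.ClassificationKit.HatBounded (kitFamilyOfRecordW 𝔇W L ι H T hT hdef h2 μ μω hμu hμω) S₀ ∧
      F0P3InnerFormClassificationV8.ClassificationKit.UnrStarAlgebra (kitFamilyOfRecordW 𝔇W L ι H T hT hdef h2 μ μω hμu hμω) S₀ ∧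
      (kitFamilyOfRecordW 𝔇W L ι H T hT hdef h2 μ μω hμu hμω).LinIndepS ∧
      F0P3InnerFormClassificationV8.ClassificationKit.UnitaryPacket (kitFamilyOfRecordW 𝔇W L ι H T hT hdef h2 μ μω hμu hμω) S₀ ∧
      F0P3InnerFormClassificationV8.ClassificationKit.Routing (kitFamilyOfRecordW 𝔇W L ι H T hT hdef h2 μ μω hμu hμω) ∧
      -- the arch clauses on the family's `jInf dsInf` (R-22′) and the ξ-rows #20 #21 #23 (no #12 `FlathDet`, no «AFA»: RULINGS (V43)(V44))
      JInfNoDegOne (𝔇W L ι H T hT hdef h2 μ μω hμu hμω).jInf ∧ DsInfNoDegOne (𝔇W L ι H T hT hdef h2 μ μω hμu hμω).dsInf ∧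
      (kitFamilyOfRecordW 𝔇W L ι H T hT hdef h2 μ μω hμu hμω).XiFamilyFin μω hμu ∧
      (kitFamilyOfRecordW 𝔇W L ι H T hT hdef h2 μ μω hμu hμω).XiUnram ∧
      (kitFamilyOfRecordW 𝔇W L ι H T hT hdef h2 μ μω hμu hμω).EvpConvention) :
    ∀ (L : Type) [Field L] [NumberField L] [IsCMField L] (ι : L →+* ℂ) (H : Matrix (Fin 3) (Fin 3) L) (T : GL (Fin 3) ℂ)
      (hT : (T : Matrix (Fin 3) (Fin 3) ℂ)ᴴ * H.map ι * (T : Matrix (Fin 3) (Fin 3) ℂ) = Literature.Geometry.ComplexHyperbolic.BallModel.J),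
      (∀ τ' : L →+* ℂ, InfinitePlace.mk τ' ≠ InfinitePlace.mk ι → (H.map τ').PosDef) → 2 ≤ Module.finrank ℚ ↥(maximalRealSubfield L) →
        3 ≤ Module.finrank ℚ ↥(maximalRealSubfield L) →
        ∀ (μA : Measure (adelicGroupData (↥(maximalRealSubfield L)) L (IsCMField.complexConj L) 3 H).automorphicQuotient)
          [(adelicGroupData (↥(maximalRealSubfield L)) L (IsCMField.complexConj L) 3 H).IsAutomorphicMeasure μA]
          (P P' : DiscreteAutomorphicRep (adelicGroupData (↥(maximalRealSubfield L)) L (IsCMField.complexConj L) 3 H) μA),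
          (P.IsHolCotangentAt (cmArchSection L ι H T hT) (cmCompactFactor L ι H T hT) ∨ P.IsAntiholCotangentAt (cmArchSection L ι H T hT) (cmCompactFactor L ι H T hT)) →
          (P'.IsHolCotangentAt (cmArchSection L ι H T hT) (cmCompactFactor L ι H T hT) ∨ P'.IsAntiholCotangentAt (cmArchSection L ι H T hT) (cmCompactFactor L ι H T hT)) →
          ∀ (μω : HeckeCharacter L) (hμu : μω.IsUnitary),
            (∀ x : Literature.NumberTheory.GaloisRepresentations.ideleGroup ↥(maximalRealSubfield L),
              μω (AdeleRing.ideleBaseChange (↥(maximalRealSubfield L)) L x) = quadraticHeckeCharCM L x) →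
          ∀ (ξ : OneDimAutRepH L),
            MemXiFamily P (transpose_map_cmConjRingHom_eq_of_frame L ι H T hT) (isUnit_det_of_frame L ι H T hT) μω hμu ξ →
            MemXiFamily P' (transpose_map_cmConjRingHom_eq_of_frame L ι H T hT) (isUnit_det_of_frame L ι H T hT) μω hμu ξ →
              Even ({v : HeightOneSpectrum (𝓞 ↥(maximalRealSubfield L)) | ¬ ((∃ c : IrrClass ((cmDatum L 3 H).Local v),
                  (IrrClass.comap (localPiEquiv L (IsCMField.complexConj L) 3 H v) c).IsConstituentOf
                      (P.finRep.smoothPart.toRepresentation.comp (inclPlace (↥(maximalRealSubfield L)) L (IsCMField.complexConj L) 3 H v)) ∧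
                    c.IsSupercuspidal) ↔
                (∃ c : IrrClass ((cmDatum L 3 H).Local v),
                  (IrrClass.comap (localPiEquiv L (IsCMField.complexConj L) 3 H v) c).IsConstituentOf
                      (P'.finRep.smoothPart.toRepresentation.comp (inclPlace (↥(maximalRealSubfield L)) L (IsCMField.complexConj L) 3 H v)) ∧
                    c.IsSupercuspidal))}.ncard) :=
  relSharpGuardedOneMeasure₃_of_T5 (kitFamilyOfRecordW 𝔇W) (isPinned_kitFamilyOfRecordW 𝔇W) (lawsV8_kitFamilyOfRecordW_of_rows₃ 𝔇W h)

end Summit.HodgeConjecture.HodgeConjecture.Cruxes.H413.F0P3RelParityOfRecordW3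

end
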